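import Summits.MatrixMultiplication.MatrixMultiplication.Theses.MarginalColumns
import Literature.Computability.AlgebraicComplexity.BorderRankMatMulThreeHalves
import Literature.Computability.AlgebraicComplexity.CoppersmithWinograd1982Crude

/-!
# `SecondColumnDominates` — stub `stub_columnSlope` (line `Sketch`, crux stmt-MatrixMultiplication-16310):
# the rectangular Landsberg–Ottaviani column slope `(2n − 1)·w ≤ R̲⟨n,n,w⟩`

Route `MatrixMultiplication/MarginalColumns`, crux D = `SecondColumnDominates`, line `Sketch`
(koszul-pivot-split). With `T n w := algBorderRank (matMulTensor ℂ n n w) = R̲⟨n,n,w⟩` (an `n × n`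
matrix times an `n × w` matrix, the COLUMN TOWER of the square format) the stub is the Koszul pivot of
the line: the slope of the column tower is at least `2n − 1`,

  `stub_columnSlope : ∀ n w, 1 ≤ n → 2·n·w ≤ T n w + w`     (i.e. `(2n − 1)·w ≤ R̲⟨n,n,w⟩`),

the rectangular case `m = n`, `l = w` of Landsberg–Ottaviani (Landsberg, *Geometry and Complexity
Theory* 2017, Thm. 2.5.2.6 = Landsberg–Ottaviani 2015, Thm. 1.2 / §3: "`R̲(M_⟨m,n,l⟩) ≥ nl(n+m−1)/m`").

## Proof (the tree's square case `LandsbergOttaviani2015_algBorderRank_matMulTensor` verbatim with `w` blocks)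

* `le_rank_koszulFlattening_vandermondeProj_matMulTensor_rect` — for the Vandermonde form of the LO
  projection `Φ = vandermondeProj p : K^{(p+1)×(p+1)} → K^{2p+1}`, the `p`-th Koszul flattening of the
  rectangular `⟨p+1, w, p+1⟩` (the flattening only sees the first format slot) is, on suitable rows and
  columns, block diagonal with `w` copies of the square matrix `M̃(Φ)`
  (`koszulFlattening_matMul_submatrix`, stated in the tree for a general middle dimension), and `M̃(Φ)`
  is injective (`matMulKoszulMatrix_vandermondeProj_injective`), so a maximal minor is `det(M̃)^w ≠ 0`:
  `C(2p+1, p+1)·(p+1)·w ≤ rank K_Φ(⟨p+1, w, p+1⟩)`.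
* `LandsbergOttaviani2015_algBorderRank_matMulTensor_rect` — with Landsberg–Ottaviani 2015, Thm. 2.1
  for the algebraic border rank (`LandsbergOttaviani2015_thm21_algBorderRank`:
  `rank K_Φ(t) ≤ C(2p,p)·R̲(t)`) and `C(2p+1,p+1)(p+1) = (2p+1)·C(2p,p)` (`Nat.add_one_mul_choose_eq`):
  `(2p+1)·w ≤ R̲⟨p+1, w, p+1⟩`; the format is moved to `⟨n, n, w⟩` by
  `algBorderRank_matMulTensor_rotate` (`R̲⟨n,n,w⟩ = R̲⟨n,w,n⟩`). Over every field of characteristic `0`.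
* `stub_columnSlope` — the registered signature over `ℂ`, subtraction-free.

All sorry-free, standard axioms. References: J. M. Landsberg, *Geometry and Complexity Theory*, CUP
2017, §2.5.2, Thm. 2.5.2.6 [LandsbergGCT2017]; J. M. Landsberg, G. Ottaviani, *New lower bounds for
the border rank of matrix multiplication*, Theory Comput. 11 (2015), Thm. 1.2, Thm. 2.1 and §3
[LandsbergOttaviani2015].
-/

-- `MatrixMultiplication.MatrixMultiplication` (summit = problem) is the tree's layout, not a typo.
set_option linter.dupNamespace false

noncomputable section

namespace Summit.MatrixMultiplication.MatrixMultiplication.Theorems.SecondColumnDominates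

open Literature.Computability.AlgebraicComplexity

universe u

section Rectangular

variable (K : Type u) [Field K] [CharZero K]

/-- For the Vandermonde form of the Landsberg–Ottaviani projection `Φ : K^{n×n} → K^{2n−1}`
(`vandermondeProj (n-1)`), the `p = n − 1` Koszul flattening of the RECTANGULAR `⟨n, w, n⟩` has rank
`≥ C(2n−1, n)·n·w` in characteristic `0`: it is `M̃(Φ) ⊗ Id_w` with `M̃(Φ)` injective
(`matMulKoszulMatrix_vandermondeProj_injective`), so the corresponding maximal minor is
`det(M̃)^w ≠ 0` — the proof of `le_rank_koszulFlattening_vandermondeProj_matMulTensor` (the case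
`w = n`) verbatim with `w` blocks. Stated with `n = p + 1`.
[cite: LandsbergGCT2017, §2.5.2, Thm. 2.5.2.6 (proof)] -/
theorem le_rank_koszulFlattening_vandermondeProj_matMulTensor_rect (p w : ℕ) :
    (2 * p + 1).choose (p + 1) * (p + 1) * w ≤
      (koszulFlattening p (vandermondeProj K p) (matMulTensor K (p + 1) w (p + 1))).rank := by
  classical
  have hcard : Fintype.card (PSub (2 * p + 1) (p + 1) × Fin (p + 1)) =
      Fintype.card (PSub (2 * p + 1) p × Fin (p + 1)) := by
    simp only [Fintype.card_prod, card_PSub, Fintype.card_fin, Nat.choose_symm_half]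
  obtain ⟨ε, hε⟩ := exists_det_submatrix_ne_zero_of_injective _ hcard
    (matMulKoszulMatrix_vandermondeProj_injective K p)
  have hM := koszulFlattening_matMul_submatrix (p + 1) w p (vandermondeProj K p)
    (ι := PSub (2 * p + 1) (p + 1) × Fin (p + 1)) id ε
  set X := (PSub (2 * p + 1) (p + 1) × Fin (p + 1)) × Fin w with hX
  set rowf : X → PSub (2 * p + 1) (p + 1) × (Fin w × Fin (p + 1)) :=
    fun x => ((id x.1).1, (x.2, (id x.1).2)) with hrowf
  set colf : X → PSub (2 * p + 1) p × (Fin (p + 1) × Fin w) :=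
    fun x => ((ε x.1).1, ((ε x.1).2, x.2)) with hcolf
  set M := koszulFlattening p (vandermondeProj K p) (matMulTensor K (p + 1) w (p + 1)) with hMdef
  have hdet : (M.submatrix rowf colf).det ≠ 0 := by
    rw [hMdef, hrowf, hcolf, hM, Matrix.det_blockDiagonal]
    exact Finset.prod_ne_zero_iff.2 fun _ _ => hε
  let e : Fin (Fintype.card X) ≃ X := (Fintype.equivFin X).symm
  have hdet' : (M.submatrix (rowf ∘ e) (colf ∘ e)).det ≠ 0 := by
    rw [show M.submatrix (rowf ∘ e) (colf ∘ e) = (M.submatrix rowf colf).submatrix e e from rfl,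
      Matrix.det_submatrix_equiv_self]
    exact hdet
  have hk := Matrix.le_rank_of_isUnit_det_submatrix _ (rowf ∘ e) (colf ∘ e)
    (isUnit_iff_ne_zero.2 hdet')
  have hcardX : Fintype.card X = (2 * p + 1).choose (p + 1) * (p + 1) * w := by
    simp only [X, Fintype.card_prod, card_PSub, Fintype.card_fin]
  rwa [hcardX] at hk

/-- **Landsberg–Ottaviani, rectangular column form: `(2p + 1)·w ≤ R̲⟨p+1, w, p+1⟩`** over every field
of characteristic `0` (Landsberg 2017, Thm. 2.5.2.6 [LO15]: "`R̲(M_⟨m,n,l⟩) ≥ nl(n+m−1)/m`", here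
`m = n = p + 1`, `l = w`): from the previous minor,
`C(2p+1,p+1)·(p+1)·w ≤ rank K_Φ(⟨p+1,w,p+1⟩) ≤ C(2p,p)·R̲⟨p+1,w,p+1⟩`
(`LandsbergOttaviani2015_thm21_algBorderRank`) and `C(2p+1,p+1)·(p+1) = (2p+1)·C(2p,p)`.
[cite: LandsbergGCT2017, §2.5.2, Thm. 2.5.2.6] -/
theorem two_mul_add_one_mul_le_algBorderRank_matMulTensor_rect (p w : ℕ) :
    (2 * p + 1) * w ≤ algBorderRank (matMulTensor K (p + 1) w (p + 1)) := by
  have h1 := le_rank_koszulFlattening_vandermondeProj_matMulTensor_rect K p w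
  have h2 := LandsbergOttaviani2015_thm21_algBorderRank p (vandermondeProj K p)
    (matMulTensor K (p + 1) w (p + 1))
  have h12 := h1.trans h2
  -- `C(2p+1, p+1) (p+1) = (2p+1) C(2p, p)`
  have hid : (2 * p + 1).choose (p + 1) * (p + 1) = (2 * p + 1) * (2 * p).choose p :=
    (Nat.add_one_mul_choose_eq (2 * p) p).symm
  have hpos : 0 < (2 * p).choose p := Nat.choose_pos (by omega)
  have h3 : (2 * p).choose p * ((2 * p + 1) * w) ≤
      (2 * p).choose p * algBorderRank (matMulTensor K (p + 1) w (p + 1)) := by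
    calc (2 * p).choose p * ((2 * p + 1) * w)
        = (2 * p + 1).choose (p + 1) * (p + 1) * w := by rw [hid]; ring
      _ ≤ _ := h12
  exact Nat.le_of_mul_le_mul_left h3 hpos

/-- **Landsberg–Ottaviani 2015, the column slope of the square format: `(2n − 1)·w ≤ R̲⟨n,n,w⟩`**
for `n ≥ 1` and every `w`, over every field of characteristic `0` (Landsberg 2017, Thm. 2.5.2.6
[LO15] with `m = n`, `l = w`; the border rank of an `n × n` matrix times an `n × w` matrix grows at
least with the Koszul slope `2n − 1` per column). From the `⟨n, w, n⟩` form by the rotation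
`R̲⟨n,n,w⟩ = R̲⟨n,w,n⟩` (`algBorderRank_matMulTensor_rotate`).
[cite: LandsbergGCT2017, §2.5.2, Thm. 2.5.2.6] -/
theorem LandsbergOttaviani2015_algBorderRank_matMulTensor_rect (n w : ℕ) (hn : 1 ≤ n) :
    (2 * n - 1) * w ≤ algBorderRank (matMulTensor K n n w) := by
  obtain ⟨p, rfl⟩ : ∃ p, n = p + 1 := ⟨n - 1, by omega⟩
  rw [algBorderRank_matMulTensor_rotate K (p + 1) (p + 1) w,
    show 2 * (p + 1) - 1 = 2 * p + 1 by omega]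
  exact two_mul_add_one_mul_le_algBorderRank_matMulTensor_rect K p w

end Rectangular

/-- **Stub `stub_columnSlope` of line `Sketch` (crux `SecondColumnDominates`), registered signature:**
for `n ≥ 1` and every `w`, `2·n·w ≤ R̲⟨n,n,w⟩ + w` over `ℂ` — the subtraction-free form of the
rectangular Landsberg–Ottaviani column slope `(2n − 1)·w ≤ R̲⟨n,n,w⟩`
(`LandsbergOttaviani2015_algBorderRank_matMulTensor_rect` at `K = ℂ`).
[cite: LandsbergGCT2017, §2.5.2, Thm. 2.5.2.6] -/
theorem stub_columnSlope :
    ∀ n w : ℕ, 1 ≤ n →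
      2 * n * w ≤
        Literature.Computability.AlgebraicComplexity.algBorderRank
          (Literature.Computability.AlgebraicComplexity.matMulTensor ℂ n n w) + w := by
  intro n w hn
  obtain ⟨p, rfl⟩ : ∃ p, n = p + 1 := ⟨n - 1, by omega⟩
  have h := two_mul_add_one_mul_le_algBorderRank_matMulTensor_rect ℂ p w
  rw [← algBorderRank_matMulTensor_rotate ℂ (p + 1) (p + 1) w] at h
  have e : 2 * (p + 1) * w = (2 * p + 1) * w + w := by ring
  omega

end Summit.MatrixMultiplication.MatrixMultiplication.Theorems.SecondColumnDominates

end
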